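import Literature.NumberTheory.Automorphic.TotallyRealModularityBoxImagesProofs
import Literature.NumberTheory.Automorphic.TotallyRealNonModularImages
import HarnessLib

/-!
# Box 2022, Theorem 7.1: over ANY totally real quartic field a non-modular elliptic curve gives a
# point on one of the sixteen curves `X(u3, v5, w7)`, `u ∈ {b, s}`, `v ∈ {b, s, ns}`, `w ∈ {b, e}`

Topic `Literature/NumberTheory/Automorphic`; companion of `TotallyRealModularity.lean`
(`Box2022_theorem1_1`: quartic fields NOT containing `√5`), `TotallyRealModularityBoxImages.lean`
(`Box2022_theorem1_3`), `TotallyRealModularityBoxImagesProofs.lean` (Thm. 1.3 from the printed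
lifting theorems: `Box2022.clause_three`, `Box2022.clause_seven_of_liftingTheorems`),
`TotallyRealModularitySmallImage.lean` (`Box2022_theorem1_5_modular`, the four `b5`-curves) and
`FLSResidualImageCriteria.lean` (the named facts `FLS2015_theorem3`, `FLS2015_theorem4`,
`Kalyanswamy2018_theorem1_2`).  Typed for the cell `pub/lg-quartmod` (F-L1: modularity of elliptic
curves over totally real quartic fields CONTAINING `√5`, route `Langlands/SqrtFiveQuarticCovers`).

**What this file is and is not.** It vendors Box's §7.1 REDUCTION for quartic fields containing
`√5` — a statement about residual images, i.e. about which modular curves carry the putative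
non-modular curves — and PROVES it from the three printed lifting theorems already in the tree.
Nothing here proves modularity of a single elliptic curve over a quartic field containing `√5`:
Box's Theorem 1.1 (`Box2022_theorem1_1`) excludes `√5 ∈ K`, and §7.1 of the source says in as many
words that the sixteen curves are "a monumental task" left open (quoted below).

## What the source prints (held text `paper:arxiv-2103.13975`, p. 30 of the text = §7.1)

J. Box, *Elliptic curves over totally real quartic fields not containing `√5` are modular*, Trans.
Amer. Math. Soc. 375 (2022) = arXiv:2103.13975 [Box2022], §7 "Further study", §7.1 "Quartic
fields containing `√5`":

> "When considering quartic fields containing `√5`, we can no longer use Thorne's theorem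
> (Theorem 1.3 (ii)). Instead, we can use [freitas], to obtain the following theorem.
> **Theorem 7.1.** Suppose that `K` is any totally real quartic field. If an elliptic curve
> `E/K` is not modular, then `E` gives rise to a `K`-point on one of the curves
> `X(u3, v5, w7)`, `u ∈ {b, s}`, `v ∈ {b, s, ns}`, `w ∈ {b, e}`.
> It was noted in [freitas] that we cannot do any better than this at `5` without stronger
> modularity lifting results for fields containing `√5`. Instead of `4` curves, we thus need to
> consider `16` curves, a monumental task. An advantage is that instead of quartic points, we now
> need to study quadratic points over `ℚ(√5)`. […] the quotient of `X(b3, ns5)` (genus `2`) by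
> `w₃` is `ℙ¹` and the quotient of `X(ns5, b7)` (genus `5`) by `w₇` is an elliptic curve with
> infinitely many `ℚ(√5)`-points. […] Those points correspond to `ℚ(√5)`-curves, which, unlike
> `ℚ`-curves, are not known to be modular. Another complicating factor is that an analysis of the
> Jacobians of `X(u3, v5, b7)` for `u ∈ {b, s}` and `v ∈ {s, ns}` […] revealed multiple
> `1`-dimensional factors corresponding to elliptic curves with positive rank over `ℚ(√5)`,
> particularly in the `ns5` case."

Notation of the source (§1.1–1.2, pp. 3–4): `X(b p)`, `X(s p)`, `X(ns p)` are the modular curves of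
the Borel subgroup, of the normaliser of a split Cartan subgroup and of the normaliser of a
non-split Cartan subgroup of `GL₂(𝔽_p)`; `X(e7)` is the curve of the group
`G(e7) = ⟨(0 5; 3 0), (5 0; 3 2)⟩ ⊆ GL₂(𝔽₇)` (= `H₂` of Freitas–Le Hung–Siksek, Prop. 9.1 (c));
"If `E` is an elliptic curve over `K` such that `Im(ρ̄_{E,N}) ⊂ G` up to conjugation, then there
exists `Q ∈ Y_G(K)` with `j(Q) = j_E`" (§1.1).  The printed proof of Thm. 7.1 is the sentence
"we can use [freitas]": at `3` and `7` it is Thm. 1.3 (i), (iii) (the hypothesis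
`K ∩ ℚ(ζ₇) = ℚ` of (iii) being automatic for a quartic field, `3 ∤ 4`), and at `5` it is
Freitas–Le Hung–Siksek 2015, Thm. 3 ("`ρ̄_{E,5}(G_{K(ζ₅)})` absolutely irreducible ⇒ `E`
modular", NO hypothesis on `√5`) followed by their Prop. 3.1 (ii) = published Prop. 4.1 (ii) ("If
`ρ̄(G_{K(ζ_p)})` is absolutely reducible, then `ρ̄(G_K)` is contained either in a Borel subgroup, or
in the normalizer of a Cartan subgroup. In this case `E` gives rise to a non-cuspidal `K`-point
on `X(b p)`, `X(s p)` or `X(ns p)`", held text `paper:arxiv-1310.7088`, p. 10).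

## Rendering (as in the sibling files; read before citing)

* "`E / K` elliptic, not modular" ⟶ an integral Weierstrass model `E / 𝓞 K` with `Δ(E) ≠ 0`
  and `¬ IsAutomorphicOfWeightZero E` (`TotallyRealModularity.lean`, "Rendering and
  faithfulness"); the weak trace-only rendering `¬ IsModularEllipticCurve K E` used by the
  summit-side statements implies it (`not_isAutomorphicOfWeightZero_of_not_isModularEllipticCurve`),
  see `Box2022.theorem7_1_of_not_isModularEllipticCurve`.
* "`E` gives rise to a `K`-point on `X(u3, v5, w7)`" ⟶ the level structures, exactly as in
  `Box2022_theorem1_3` / `Box2022_theorem1_5_modular` and in the route file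
  `Summits/Langlands/Langlands/Theses/SqrtFiveQuarticCovers.lean`: for SOME framing `ρ̄_p` of the
  Galois action on `E[p]` (`WeierstrassCurve.IsTorsionGaloisRep`; all framings are conjugate):
  `p = 3`: `ρ̄₃(Γ_K) ⊆ B(3)` (entry `(1,0)` zero) or `⊆ C_s⁺(3) = ⟨diag(1,2), (0 1; 1 0)⟩`;
  `p = 5`: `ρ̄₅(Γ_K) ⊆ B(5)`, or `⊆ N(C)` for a SPLIT Cartan subgroup `C = P (* 0; 0 *) P⁻¹`
  (`Serre1972.splitCartan P`), or `⊆ N(kˣ)` for a NON-SPLIT Cartan subgroup `kˣ`, `k ⊆ M₂(𝔽₅)` a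
  field of degree `2` (`Serre1972.unitGroup k`) — Serre 1972 §2.1 as vendored in
  `SerreCartanSubgroupsGL2Fp.lean`, the union of the two families being `Serre1972.cartanSubgroups`;
  `p = 7`: `ρ̄₇(Γ_K) ⊆ B(7)` or `⊆ G(e7) = ⟨(0 5; 3 0), (5 0; 3 2)⟩`.
* "any totally real quartic field" ⟶ `NumberField K`, `IsTotallyReal K`, `Module.finrank ℚ K = 4`;
  NO hypothesis on `√5`.

## Contents

* NO named fact is introduced (D-0026): Theorem 7.1 is stated AND proved as the theorem
  `Box2022.theorem7_1`, whose hypotheses are the three named facts of the tree it rests on —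
  `(h3 : FLS2015_theorem3) (h4 : FLS2015_theorem4) (hKal : Kalyanswamy2018_theorem1_2)` — so that a
  consumer writes `Box2022.theorem7_1 h3 h4 hKal` where it would have written `(h : Box2022_theorem7_1)`.
* `Box2022.clause_five` — the `5`-part for ANY totally real `K`, from `FLS2015_theorem3` alone:
  FLS Thm. 3 at `p = 5` (contrapositive) gives a framing `ρ̄` with `ρ̄|_{Γ_{K(ζ₅)}}` not absolutely
  irreducible; a reducible `ρ̄` is Borel after a change of framing
  (`FLS2015.exists_isTorsionGaloisRep_borel_of_not_isIrreducible`); an irreducible one has image in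
  the normaliser of a Cartan subgroup by FLS Lemma 3.2 = published Lemma 4.2, in the tree
  Caraiani–Newton's Lemma 7.1.1 (1) (`CaraianiNewton.exists_le_normalizer_cartan`, PROVED), fed
  through the dictionary of `CyclotomicDeterminantImageProofs.lean` (`det ρ̄_{E,5} = χ̄₅`,
  `WeierstrassCurve.det_eq_modPCyclotomicCharacter_of_isTorsionGaloisRep_holds`).
* `Box2022.theorem7_1` — **Thm. 7.1 PROVED from `FLS2015_theorem3`, `FLS2015_theorem4`,
  `Kalyanswamy2018_theorem1_2`** (the printed proof: `Box2022.clause_three`, `Box2022.clause_five`,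
  `Box2022.clause_seven_of_liftingTheorems` with `Box2022.cubic7_ne_zero`) — the same inputs as
  `Box2022_theorem1_3_of_fourLiftingTheorems`, minus Thorne 2016 (which needs `√5 ∉ K`).
* `Box2022.theorem7_1_of_not_isModularEllipticCurve` — the statement on the weak rendering of
  "modular" and with `IsTotallyReal K` as an explicit hypothesis, token-compatible with the route
  statements of `SqrtFiveQuarticCovers`.
* The case `√5 ∈ K` (the object of §7.1) needs no separate statement: `Box2022.clause_five` has no
  hypothesis on `√5`, and this trichotomy `v ∈ {b, s, ns}` — not Thm. 1.3 (ii) (Thorne: `√5 ∉ K`)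
  — is what print offers at `5` over such fields; the route's refinement of `{s5, ns5}` to the
  index-`2` subgroups `H8 ⊂ C_s⁺(5)`, `H12 ⊂ C_ns⁺(5)` (FLS Remark (iii) after Cor. 2.1: for
  `√5 ∈ K`, `det ρ̄_{E,5} = χ̄₅ ∈ {±1}`; tree: `KisinTaylorWilesHypothesisFive.lean`) is route-side
  and not restated here.

## References

* [Box2022] J. Box, Trans. Amer. Math. Soc. 375 (2022), doi:10.1090/tran/8557 = arXiv:2103.13975,
  §7.1, Theorem 7.1 and the two paragraphs following it (held text p. 30); §1.1–1.2, Thms. 1.1–1.3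
  (held text pp. 3–4).
* [FreitasLeHungSiksek2015] N. Freitas, B. V. Le Hung, S. Siksek, Invent. Math. 201 (2015)
  159–206 = arXiv:1310.7088, Thm. 3 (held text p. 4), Prop. 3.1 and Lemma 3.2 = published 4.1, 4.2
  (held text p. 10), Remark (iii) after Cor. 2.1 = published 10.1 (held text p. 20).
* [Kalyanswamy2018] Math. Res. Lett. 25 (2018), Thm. 1.2; [CaraianiNewton2023] Lemma 7.1.1 (1)
  (tree: `CartanNormalizerCriterionGL2Fp.lean`); [Serre1972] §2.1 (tree: `SerreCartanSubgroupsGL2Fp.lean`).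
-/

open scoped NumberField MatrixGroups
open NumberField Field Matrix Literature.NumberTheory.GaloisRepresentations

noncomputable section

namespace Literature.NumberTheory.Automorphic

universe u

/-! ### The `5`-clause over any totally real field (FLS Thm. 3 + Prop. 3.1 (ii)) -/

namespace Box2022

/-- **The level structure at `5` of a non-modular elliptic curve over a totally real field**
(Box 2022, proof of Thm. 7.1 at `5` = Freitas–Le Hung–Siksek 2015, Thm. 3 with their Prop. 3.1
(ii): "If `ρ̄(G_{K(ζ_p)})` is absolutely reducible, then `ρ̄(G_K)` is contained either in a Borel
subgroup, or in the normalizer of a Cartan subgroup. In this case `E` gives rise to a non-cuspidal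
`K`-point on `X(b p)`, `X(s p)` or `X(ns p)`").  For `K` totally real (no hypothesis on `√5`) and
`E / 𝓞 K` with `Δ(E) ≠ 0` not automorphic of weight zero, some framing `ρ̄` of `(E ⊗ K)[5]` has
image in `B(5)`, or in the normaliser of a split Cartan subgroup `P (* 0; 0 *) P⁻¹`, or in the
normaliser of a non-split Cartan subgroup `kˣ` (`k ⊆ M₂(𝔽₅)` a field of degree `2`).  Proof: FLS
Thm. 3 at `p = 5` (`FLS2015_theorem3`, contrapositive) yields a framing whose restriction to a
model of `K(ζ₅)` is not absolutely irreducible; if the framing is reducible a conjugate framing is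
upper triangular (`FLS2015.exists_isTorsionGaloisRep_borel_of_not_isIrreducible`); otherwise its
image fixes no line, its determinant-one elements (restrictions from `Γ_{K(ζ₅)}`, as
`det ρ̄ = χ̄₅`) have a common eigenvector over an extension of `𝔽₅`
(`exists_eigenvector_of_det_eq_one_of_not_isAbsolutelyIrreducible_restrictField`), and Lemma 3.2
of the source in the tree's proved form `CaraianiNewton.exists_le_normalizer_cartan` (`p = 5 ≠ 2`)
puts the image in the normaliser of a Cartan subgroup (`Serre1972.cartanSubgroups` = split ∪
non-split). [cite: Box2022, Thm. 7.1 (proof, "we can use [freitas]")]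
[cite: FreitasLeHungSiksek2015, Thm. 3 and Prop. 3.1 (ii), Lemma 3.2 (p. 10 of arXiv:1310.7088)] -/
theorem clause_five (h3 : FLS2015_theorem3) (K : Type) [Field K] [NumberField K]
    [IsTotallyReal K] (E : WeierstrassCurve (𝓞 K)) (hΔ : E.Δ ≠ 0)
    (hne : ¬ IsAutomorphicOfWeightZero E) :
    ∃ ρ : FramedGaloisRep K (ZMod 5) 2, (E.baseChange K).IsTorsionGaloisRep 5 ρ ∧
      ((∀ σ : absoluteGaloisGroup K,
          ((ρ σ : GL (Fin 2) (ZMod 5)) : Matrix (Fin 2) (Fin 2) (ZMod 5)) 1 0 = 0) ∨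
        (∃ P : GL (Fin 2) (ZMod 5), ∀ σ : absoluteGaloisGroup K,
          ρ σ ∈ Subgroup.normalizer (Serre1972.splitCartan P : Set (GL (Fin 2) (ZMod 5)))) ∨
        (∃ k : Subalgebra (ZMod 5) (Matrix (Fin 2) (Fin 2) (ZMod 5)),
          IsField k ∧ Module.finrank (ZMod 5) k = 2 ∧ ∀ σ : absoluteGaloisGroup K,
            ρ σ ∈ Subgroup.normalizer (Serre1972.unitGroup k : Set (GL (Fin 2) (ZMod 5))))) := by
  haveI : Fact (Nat.Prime 5) := ⟨by norm_num⟩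
  haveI := FLS2015.isElliptic_baseChange hΔ
  haveI : NeZero ((5 : ℕ) : K) := NeZero.charZero
  -- FLS Thm. 3 at `p = 5`, contrapositive: some framing restricted to some model of `K(ζ₅)` is
  -- not absolutely irreducible
  obtain ⟨ρ, hρ, L, _, _, _, hred⟩ :
      ∃ ρ : ModPGaloisRep K (ZMod 5) 2, (E.baseChange K).IsTorsionGaloisRep 5 ρ ∧
        ∃ (L : Type) (_ : Field L) (_ : Algebra K L) (_ : IsCyclotomicExtension {5} K L),
          ¬ FramedRep.IsAbsolutelyIrreducible (FramedGaloisRep.restrictField L ρ) := by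
    by_contra hall
    push Not at hall
    refine hne (h3 K E hΔ 5 (Or.inr rfl) ?_)
    intro ρ hρ L _ _ _
    exact hall ρ hρ L inferInstance inferInstance inferInstance
  by_cases hirr : FramedRep.IsIrreducible ρ
  swap
  · -- reducible: Borel after a change of framing
    obtain ⟨ρ', hρ', hB⟩ := FLS2015.exists_isTorsionGaloisRep_borel_of_not_isIrreducible hρ hirr
    exact ⟨ρ', hρ', Or.inl hB⟩
  -- irreducible: the image lies in the normaliser of a Cartan subgroup (FLS Lemma 3.2)
  refine ⟨ρ, hρ, Or.inr ?_⟩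
  have hdet : ∀ σ, Matrix.GeneralLinearGroup.det (ρ σ) = modPCyclotomicCharacterZMod K 5 σ :=
    (E.baseChange K).det_eq_modPCyclotomicCharacter_of_isTorsionGaloisRep_holds 5 ρ hρ
  obtain ⟨B, _, f, v, hv, hB⟩ :=
    exists_eigenvector_of_det_eq_one_of_not_isAbsolutelyIrreducible_restrictField ρ hdet L hred
  set G : Subgroup (GL (Fin 2) (ZMod 5)) := ρ.toMonoidHom.range with hG
  have hirr' : ∀ (w : Fin 2 → ZMod 5) (hw : w ≠ 0), ¬ G ≤ eigenvectorStabilizer w hw := by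
    intro w hw hle
    obtain ⟨g, hg, hne'⟩ := FLS2015.range_irreducible ρ hirr w hw
    obtain ⟨a, ha⟩ := mem_eigenvectorStabilizer_iff.mp (hle hg)
    exact hne' a ha
  have hred' : ∃ (L' : Type) (_ : Field L') (f' : ZMod 5 →+* L') (v' : Fin 2 → L'), v' ≠ 0 ∧
      ∀ g ∈ G, Matrix.GeneralLinearGroup.det g = 1 →
        ∃ c : L', ((g : Matrix (Fin 2) (Fin 2) (ZMod 5)).map f') *ᵥ v' = c • v' := by
    refine ⟨B, inferInstance, f, v, hv, ?_⟩
    rintro _ ⟨σ, rfl⟩ hσ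
    exact hB σ hσ
  obtain ⟨C, hC, hGC⟩ :=
    CaraianiNewton.exists_le_normalizer_cartan.{0} (p := 5) (by decide) G hirr' hred'
  have hmem : ∀ σ : absoluteGaloisGroup K,
      ρ σ ∈ Subgroup.normalizer (C : Set (GL (Fin 2) (ZMod 5))) := fun σ => hGC ⟨σ, rfl⟩
  rcases hC with ⟨P, rfl⟩ | ⟨k, hk, hk2, rfl⟩
  · exact Or.inl ⟨P, hmem⟩
  · exact Or.inr ⟨k, hk, hk2, hmem⟩

end Box2022

/-! ### Theorem 7.1 from the three printed lifting theorems -/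

/-- **Box 2022, Theorem 7.1, PROVED from its printed inputs** `FLS2015_theorem3` (the `3`- and
`5`-parts: Thm. 1.3 (i) = `Box2022.clause_three`, and `Box2022.clause_five`), `FLS2015_theorem4` and
`Kalyanswamy2018_theorem1_2` (the `7`-part: Thm. 1.3 (iii) = `Box2022.clause_seven_of_liftingTheorems`,
whose hypothesis "`X³ + X² − 2X − 1` has no root in `K`", i.e. `K ∩ ℚ(ζ₇) = ℚ`, is automatic for a
quartic field: `Box2022.cubic7_ne_zero`, `3 ∤ 4`).  This is the source's proof: "we can use
[freitas], to obtain the following theorem".  Statement: "Suppose that `K` is any totally real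
quartic field. If an elliptic curve `E/K` is not modular, then `E` gives rise to a `K`-point on one
of the curves `X(u3, v5, w7)`, `u ∈ {b, s}`, `v ∈ {b, s, ns}`, `w ∈ {b, e}`" — rendered (module
docstring "Rendering"): for `K` a totally real number field of degree `4` — NO hypothesis on `√5` —
and `E / 𝓞 K` with `Δ(E) ≠ 0` and `¬ IsAutomorphicOfWeightZero E`: (3) some framing `ρ̄₃` of `E[3]`
has image in `B(3)` or in `C_s⁺(3) = ⟨diag(1,2), (0 1; 1 0)⟩`; (5) some framing `ρ̄₅` of `E[5]`
has image in `B(5)`, or in the normaliser of a split Cartan subgroup `P (* 0; 0 *) P⁻¹`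
(`Serre1972.splitCartan`), or in the normaliser of a non-split Cartan subgroup `kˣ`,
`k ⊆ M₂(𝔽₅)` a field of degree `2` (`Serre1972.unitGroup`); (7) some framing `ρ̄₇` of `E[7]` has
image in `B(7)` or in `G(e7) = ⟨(0 5; 3 0), (5 0; 3 2)⟩`.  A REDUCTION, not a modularity theorem:
for `√5 ∈ K` the sixteen curves are open in print (§7.1, quoted in the module docstring); no named
fact is introduced (the three inputs are hypotheses). [cite: Box2022, Thm. 7.1 (§7.1, p. 30 of arXiv:2103.13975)]
[cite: FreitasLeHungSiksek2015, Thms. 3–4, Prop. 3.1 (ii)] [cite: Kalyanswamy2018, Thm. 1.2] -/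
theorem Box2022.theorem7_1 (h3 : FLS2015_theorem3) (h4 : FLS2015_theorem4)
    (hKal : Kalyanswamy2018_theorem1_2) :
    ∀ (K : Type) [Field K] [NumberField K] [IsTotallyReal K], Module.finrank ℚ K = 4 →
      ∀ E : WeierstrassCurve (𝓞 K), E.Δ ≠ 0 → ¬ IsAutomorphicOfWeightZero E →
        (∃ ρ : FramedGaloisRep K (ZMod 3) 2, (E.baseChange K).IsTorsionGaloisRep 3 ρ ∧
          ((∀ σ : absoluteGaloisGroup K,
              ((ρ σ : GL (Fin 2) (ZMod 3)) : Matrix (Fin 2) (Fin 2) (ZMod 3)) 1 0 = 0) ∨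
            (∀ σ : absoluteGaloisGroup K, (ρ σ : GL (Fin 2) (ZMod 3)) ∈
              Subgroup.closure ({(⟨!![1, 0; 0, 2], !![1, 0; 0, 2], by decide, by decide⟩ :
                  GL (Fin 2) (ZMod 3)),
                (⟨!![0, 1; 1, 0], !![0, 1; 1, 0], by decide, by decide⟩ : GL (Fin 2) (ZMod 3))} :
                Set (GL (Fin 2) (ZMod 3)))))) ∧
        (∃ ρ : FramedGaloisRep K (ZMod 5) 2, (E.baseChange K).IsTorsionGaloisRep 5 ρ ∧
          ((∀ σ : absoluteGaloisGroup K,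
              ((ρ σ : GL (Fin 2) (ZMod 5)) : Matrix (Fin 2) (Fin 2) (ZMod 5)) 1 0 = 0) ∨
            (∃ P : GL (Fin 2) (ZMod 5), ∀ σ : absoluteGaloisGroup K,
              ρ σ ∈ Subgroup.normalizer (Serre1972.splitCartan P : Set (GL (Fin 2) (ZMod 5)))) ∨
            (∃ k : Subalgebra (ZMod 5) (Matrix (Fin 2) (Fin 2) (ZMod 5)),
              IsField k ∧ Module.finrank (ZMod 5) k = 2 ∧ ∀ σ : absoluteGaloisGroup K,
                ρ σ ∈ Subgroup.normalizer (Serre1972.unitGroup k : Set (GL (Fin 2) (ZMod 5)))))) ∧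
        (∃ ρ : FramedGaloisRep K (ZMod 7) 2, (E.baseChange K).IsTorsionGaloisRep 7 ρ ∧
          ((∀ σ : absoluteGaloisGroup K,
              ((ρ σ : GL (Fin 2) (ZMod 7)) : Matrix (Fin 2) (Fin 2) (ZMod 7)) 1 0 = 0) ∨
            (∀ σ : absoluteGaloisGroup K, (ρ σ : GL (Fin 2) (ZMod 7)) ∈
              Subgroup.closure ({(⟨!![0, 5; 3, 0], !![0, 5; 3, 0], by decide, by decide⟩ :
                  GL (Fin 2) (ZMod 7)),
                (⟨!![5, 0; 3, 2], !![3, 0; 6, 4], by decide, by decide⟩ : GL (Fin 2) (ZMod 7))} :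
                Set (GL (Fin 2) (ZMod 7)))))) := by
  intro K _ _ _ hd E hΔ hne
  have h3' : ¬ 3 ∣ Module.finrank ℚ K := by rw [hd]; decide
  exact ⟨Box2022.clause_three h3 K E hΔ hne, Box2022.clause_five h3 K E hΔ hne,
    Box2022.clause_seven_of_liftingTheorems h4 hKal K E hΔ hne fun x => Box2022.cubic7_ne_zero h3' x⟩

/-! ### Bookkeeping forms consumed by the summit-side statements -/

/-- **Thm. 7.1 on the weak rendering of "modular".** For `K` totally real of degree `4`
(`IsTotallyReal K` as an explicit hypothesis, as in the route statements of
`Langlands/SqrtFiveQuarticCovers`) and `E / 𝓞 K` (`Δ ≠ 0`) NOT modular even in the trace-only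
sense `IsModularEllipticCurve K E` of Caraiani–Newton (the notion the route items write out by its
definition), the three level structures of `Box2022.theorem7_1` hold — via
`not_isAutomorphicOfWeightZero_of_not_isModularEllipticCurve`; inputs the three lifting facts.
[cite: Box2022, Thm. 7.1] -/
theorem Box2022.theorem7_1_of_not_isModularEllipticCurve (h3 : FLS2015_theorem3)
    (h4 : FLS2015_theorem4) (hKal : Kalyanswamy2018_theorem1_2) (K : Type)
    [Field K] [NumberField K] (hK : IsTotallyReal K) (hd : Module.finrank ℚ K = 4)
    (E : WeierstrassCurve (𝓞 K)) (hΔ : E.Δ ≠ 0) (hE : ¬ IsModularEllipticCurve K E) :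
    (∃ ρ : FramedGaloisRep K (ZMod 3) 2, (E.baseChange K).IsTorsionGaloisRep 3 ρ ∧
        ((∀ σ : absoluteGaloisGroup K,
            ((ρ σ : GL (Fin 2) (ZMod 3)) : Matrix (Fin 2) (Fin 2) (ZMod 3)) 1 0 = 0) ∨
          (∀ σ : absoluteGaloisGroup K, (ρ σ : GL (Fin 2) (ZMod 3)) ∈
            Subgroup.closure ({(⟨!![1, 0; 0, 2], !![1, 0; 0, 2], by decide, by decide⟩ :
                GL (Fin 2) (ZMod 3)),
              (⟨!![0, 1; 1, 0], !![0, 1; 1, 0], by decide, by decide⟩ : GL (Fin 2) (ZMod 3))} :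
              Set (GL (Fin 2) (ZMod 3)))))) ∧
      (∃ ρ : FramedGaloisRep K (ZMod 5) 2, (E.baseChange K).IsTorsionGaloisRep 5 ρ ∧
        ((∀ σ : absoluteGaloisGroup K,
            ((ρ σ : GL (Fin 2) (ZMod 5)) : Matrix (Fin 2) (Fin 2) (ZMod 5)) 1 0 = 0) ∨
          (∃ P : GL (Fin 2) (ZMod 5), ∀ σ : absoluteGaloisGroup K,
            ρ σ ∈ Subgroup.normalizer (Serre1972.splitCartan P : Set (GL (Fin 2) (ZMod 5)))) ∨
          (∃ k : Subalgebra (ZMod 5) (Matrix (Fin 2) (Fin 2) (ZMod 5)),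
            IsField k ∧ Module.finrank (ZMod 5) k = 2 ∧ ∀ σ : absoluteGaloisGroup K,
              ρ σ ∈ Subgroup.normalizer (Serre1972.unitGroup k : Set (GL (Fin 2) (ZMod 5)))))) ∧
      (∃ ρ : FramedGaloisRep K (ZMod 7) 2, (E.baseChange K).IsTorsionGaloisRep 7 ρ ∧
        ((∀ σ : absoluteGaloisGroup K,
            ((ρ σ : GL (Fin 2) (ZMod 7)) : Matrix (Fin 2) (Fin 2) (ZMod 7)) 1 0 = 0) ∨
          (∀ σ : absoluteGaloisGroup K, (ρ σ : GL (Fin 2) (ZMod 7)) ∈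
            Subgroup.closure ({(⟨!![0, 5; 3, 0], !![0, 5; 3, 0], by decide, by decide⟩ :
                GL (Fin 2) (ZMod 7)),
              (⟨!![5, 0; 3, 2], !![3, 0; 6, 4], by decide, by decide⟩ : GL (Fin 2) (ZMod 7))} :
              Set (GL (Fin 2) (ZMod 7)))))) := by
  haveI := hK
  exact Box2022.theorem7_1 h3 h4 hKal K hd E hΔ
    (not_isAutomorphicOfWeightZero_of_not_isModularEllipticCurve hΔ hE)

end Literature.NumberTheory.Automorphic

end
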